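import Literature.Analysis.FluidPDE.AxisymRadialQuotient
import Literature.Analysis.FluidPDE.AxisymHouLiVariables
import Literature.Analysis.FluidPDE.HydrodynamicImpulse
import Literature.Analysis.Calculus.HadamardLemma
import Mathlib.Analysis.Calculus.LineDeriv.IntegrationByParts
import HarnessLib

/-!
# The axial ray mean `α = ψ/r²` of a swirl-free divergence-free field (disprover g5 on item 19249)

First of three files (`AxialRayMean` → `EnergyImpulseBound` → `CapStratumEnergyBound`) proving the
energy–impulse–speed inequality `E(u) ≤ ¼ · sup‖u‖ · ∫ (x × curl u)₃` and, with it, the UNCONDITIONAL energy door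
of the silent signed swirl-free sub-register of `HeredityAtOne` (the brick `hκ` of `CapStratumEnergyWindow.lean`
discharged with `κ = ¼`). No definitions, no named facts: the ray mean is written out as
`∫ s in (0:ℝ)..1, s * u (scaleH s x) 2` throughout.

This file is pure calculus of the **axial ray mean** `α(x) = ∫₀¹ s · u₂(s x₀, s x₁, x₂) ds` of a `C¹` field `u`
(`= ψ/r²` for the Stokes stream function `ψ` of an axisymmetric swirl-free field, Choi (2.5):
`u = (−∂_zψ/r) e_r + (∂_rψ/r) e_z`; compare the tree's `radQuot`, the same ray average applied to `(∂ᵣS)/r`):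

* `contDiff_axialRayMean`, `abs_axialRayMean_le` (`|α| ≤ U/2` if `‖u‖ ≤ U`), `fderiv_axialRayMean_apply`
  (differentiation under the integral, `Dα(x)[y] = ∫₀¹ s Du₂(scaleH s x)[scaleH s y] ds`),
  `fderiv_axialRayMean_single_two`, `fderiv_axialRayMean_horiz`;
* `apply_two_eq` — **(P3)** `u₂ = 2α + x_h·∇α` (fundamental theorem of calculus along the ray; any `C¹` field);
* `noSwirl_fderiv`, `apply_mul_hdiv_eq` — derivatives of the vanishing swirl `x₀u₁ − x₁u₀ ≡ 0`, giving
  `x_i (∂₀u₀ + ∂₁u₁) = u_i + x_h·∇u_i` (`i = 0,1`) for swirl-free fields;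
* `apply_horiz_eq` — **(Ph)** `u_i = −x_i ∂₂α` (`i = 0,1`) for swirl-free divergence-free `C¹` fields
  (so `u = 2α e₂ + (x_h·∇α) e₂ − (∂₂α) x_h = curl (α (−x₁, x₀, 0))`: `α` is a Cartesian stream potential).

References: K. Choi, *Stability of Hill's spherical vortex*, CPAM (2024), §2.1 [cite: Choi2023, §2.1 (2.5)];
P. G. Saffman, *Vortex Dynamics* (1992), §3.2 [cite: Saffman1992, §3.2 eq. (3.2.11)].
-/

noncomputable section

namespace Summit.NavierStokesRegularity.HeredityAtOneEnergyBound

open Set MeasureTheory Filter Topology Function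
open scoped ContDiff ENNReal Topology
open Literature.Analysis Literature.Analysis.FluidPDE

variable {u : EuclideanSpace ℝ (Fin 3) → EuclideanSpace ℝ (Fin 3)}

/-! ## Horizontal part and the axial ray mean `α = ψ/r²` -/

/-- `scaleH s x_h = s • x_h`. [folklore] -/
theorem scaleH_horiz (s : ℝ) (x : EuclideanSpace ℝ (Fin 3)) : scaleH s (((x 0) • EuclideanSpace.single (0 : Fin 3) (1 : ℝ) + (x 1) • EuclideanSpace.single (1 : Fin 3) (1 : ℝ))) = s • ((x 0) • EuclideanSpace.single (0 : Fin 3) (1 : ℝ) + (x 1) • EuclideanSpace.single (1 : Fin 3) (1 : ℝ)) := by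
  ext i
  fin_cases i <;> simp

/-- `(scaleH s x)_h = s • x_h`. [folklore] -/
theorem horiz_scaleH (s : ℝ) (x : EuclideanSpace ℝ (Fin 3)) : (((scaleH s x) 0) • EuclideanSpace.single (0 : Fin 3) (1 : ℝ) + ((scaleH s x) 1) • EuclideanSpace.single (1 : Fin 3) (1 : ℝ)) = s • ((x 0) • EuclideanSpace.single (0 : Fin 3) (1 : ℝ) + (x 1) • EuclideanSpace.single (1 : Fin 3) (1 : ℝ)) := by
  ext i
  fin_cases i <;> simp

/-- `scaleH s e₂ = e₂`. [folklore] -/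
theorem scaleH_single_two (s : ℝ) :
    scaleH s (EuclideanSpace.single (2 : Fin 3) (1 : ℝ)) = EuclideanSpace.single (2 : Fin 3) (1 : ℝ) := by
  ext i
  fin_cases i <;> simp

/-- The integrand of the axial ray mean is `Cⁿ` in `(x, s)` when `u ∈ Cⁿ`. [folklore] -/
theorem contDiff_axialRayMean_integrand {n : WithTop ℕ∞} (hu : ContDiff ℝ n u) :
    ContDiff ℝ n (uncurry fun (x : EuclideanSpace ℝ (Fin 3)) (s : ℝ) => s * u (scaleH s x) 2) :=
  contDiff_snd.mul ((contDiff_apply_coord_vec3 hu 2).comp contDiff_scaleH_uncurry)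

/-- `u ∈ Cⁿ ⇒ α ∈ Cⁿ`. [folklore] -/
theorem contDiff_axialRayMean {n : ℕ∞} (hu : ContDiff ℝ n u) : ContDiff ℝ n (fun x => ∫ s in (0 : ℝ)..1, s * u (scaleH s x) 2) :=
  Calculus.contDiff_intervalIntegral (contDiff_axialRayMean_integrand hu) 0 1

/-- `|v i| ≤ ‖v‖` on `ℝ³`. [folklore] -/
theorem abs_apply_le_norm (v : EuclideanSpace ℝ (Fin 3)) (i : Fin 3) : |v i| ≤ ‖v‖ := by
  rw [EuclideanSpace.norm_eq, ← Real.sqrt_sq_eq_abs]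
  refine Real.sqrt_le_sqrt ?_
  have h := Finset.single_le_sum (f := fun j : Fin 3 => ‖v j‖ ^ 2) (fun j _ => sq_nonneg _)
    (Finset.mem_univ i)
  simpa only [Real.norm_eq_abs, sq_abs] using h

/-- `|α(x)| ≤ U/2` when `‖u‖ ≤ U`. [folklore] -/
theorem abs_axialRayMean_le (hu : Continuous u) {U : ℝ} (hU : ∀ x, ‖u x‖ ≤ U)
    (x : EuclideanSpace ℝ (Fin 3)) : |(∫ s in (0 : ℝ)..1, s * u (scaleH s x) 2)| ≤ U / 2 := by
  have hc : Continuous fun s : ℝ => s * u (scaleH s x) 2 :=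
    continuous_id.mul ((continuous_apply 2).comp
      ((PiLp.continuous_ofLp 2 _).comp (hu.comp (continuous_scaleH_left x))))
  have h1 : |(∫ s in (0 : ℝ)..1, s * u (scaleH s x) 2)| ≤ ∫ s in (0 : ℝ)..1, |s * u (scaleH s x) 2| :=
    intervalIntegral.abs_integral_le_integral_abs zero_le_one
  have h2 : ∫ s in (0 : ℝ)..1, |s * u (scaleH s x) 2| ≤ ∫ s in (0 : ℝ)..1, U * s := by
    refine intervalIntegral.integral_mono_on zero_le_one (hc.abs.intervalIntegrable 0 1)
      ((continuous_const.mul continuous_id).intervalIntegrable 0 1) fun s hs => ?_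
    rw [abs_mul, abs_of_nonneg hs.1, mul_comm]
    exact mul_le_mul_of_nonneg_right ((abs_apply_le_norm _ 2).trans (hU _)) hs.1
  have h3 : ∫ s in (0 : ℝ)..1, U * s = U / 2 := by
    rw [intervalIntegral.integral_const_mul, integral_id]; ring
  linarith

/-! ## Calculus of the axial ray mean -/

/-- `s ↦ u_i(scaleH s x)` has derivative `Du(scaleH s x)[x_h]_i`. [folklore] -/
theorem hasDerivAt_apply_comp_scaleH (hu : ContDiff ℝ 1 u) (x : EuclideanSpace ℝ (Fin 3))
    (i : Fin 3) (s : ℝ) :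
    HasDerivAt (fun s => u (scaleH s x) i) (fderiv ℝ u (scaleH s x) (((x 0) • EuclideanSpace.single (0 : Fin 3) (1 : ℝ) + (x 1) • EuclideanSpace.single (1 : Fin 3) (1 : ℝ))) i) s := by
  have hd : HasFDerivAt (fun y => u y i)
      ((EuclideanSpace.proj (𝕜 := ℝ) i).comp (fderiv ℝ u (scaleH s x))) (scaleH s x) :=
    (EuclideanSpace.proj (𝕜 := ℝ) i).hasFDerivAt.comp _
      ((hu.differentiable one_ne_zero) _).hasFDerivAt
  exact hd.comp_hasDerivAt s (hasDerivAt_scaleH x s)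

/-- `s ↦ Du(scaleH s x)[v]_i` is continuous for `u ∈ C¹`. [folklore] -/
theorem continuous_fderiv_scaleH_apply (hu : ContDiff ℝ 1 u) (x v : EuclideanSpace ℝ (Fin 3))
    (i : Fin 3) : Continuous fun s : ℝ => fderiv ℝ u (scaleH s x) v i :=
  (continuous_apply i).comp ((PiLp.continuous_ofLp 2 _).comp
    (((hu.continuous_fderiv one_ne_zero).comp (continuous_scaleH_left x)).clm_apply continuous_const))

/-- `s ↦ u_i(scaleH s x)` is continuous. [folklore] -/
theorem continuous_apply_comp_scaleH (hu : Continuous u) (x : EuclideanSpace ℝ (Fin 3)) (i : Fin 3) :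
    Continuous fun s : ℝ => u (scaleH s x) i :=
  (continuous_apply i).comp ((PiLp.continuous_ofLp 2 _).comp (hu.comp (continuous_scaleH_left x)))

/-- **Differentiation under the integral**: `Dα(x)[y] = ∫₀¹ s · Du₂(scaleH s x)[scaleH s y] ds`.
[folklore] -/
theorem fderiv_axialRayMean_apply (hu : ContDiff ℝ 1 u) (x y : EuclideanSpace ℝ (Fin 3)) :
    fderiv ℝ (fun x => ∫ s in (0 : ℝ)..1, s * u (scaleH s x) 2) x y =
      ∫ s in (0 : ℝ)..1, s * fderiv ℝ u (scaleH s x) (scaleH s y) 2 := by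
  have hF := contDiff_axialRayMean_integrand (n := 1) hu
  have h0 := Calculus.fderiv_intervalIntegral_apply_eq_partialFDerivFst hF one_ne_zero 0 1 x y
  rw [h0]
  refine intervalIntegral.integral_congr fun s _ => ?_
  show Calculus.partialFDerivFst (fun (x : EuclideanSpace ℝ (Fin 3)) (s : ℝ) =>
    s * u (scaleH s x) 2) x s y = s * fderiv ℝ u (scaleH s x) (scaleH s y) 2
  rw [← Calculus.fderiv_eq_partialFDerivFst hF one_ne_zero x s]
  have h1 : HasFDerivAt (fun x => u (scaleH s x) 2)
      (((EuclideanSpace.proj (𝕜 := ℝ) (2 : Fin 3)).comp (fderiv ℝ u (scaleH s x))).comp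
        (scaleHL s)) x :=
    ((EuclideanSpace.proj (𝕜 := ℝ) (2 : Fin 3)).hasFDerivAt.comp _
      ((hu.differentiable one_ne_zero) _).hasFDerivAt).comp x (hasFDerivAt_scaleH s x)
  rw [show (fun x => s * u (scaleH s x) 2) = fun x => s * (fun x => u (scaleH s x) 2) x from rfl,
    (h1.const_mul s).fderiv]
  simp only [smul_apply, ContinuousLinearMap.comp_apply, scaleHL_apply, smul_eq_mul]
  rfl

/-- `∂₂α(x) = ∫₀¹ s · ∂₂u₂(scaleH s x) ds`. [folklore] -/
theorem fderiv_axialRayMean_single_two (hu : ContDiff ℝ 1 u) (x : EuclideanSpace ℝ (Fin 3)) :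
    fderiv ℝ (fun x => ∫ s in (0 : ℝ)..1, s * u (scaleH s x) 2) x (EuclideanSpace.single (2 : Fin 3) (1 : ℝ)) =
      ∫ s in (0 : ℝ)..1, s * fderiv ℝ u (scaleH s x) (EuclideanSpace.single (2 : Fin 3) (1 : ℝ)) 2 := by
  rw [fderiv_axialRayMean_apply hu]
  simp only [scaleH_single_two]

/-- `Dα(x)[x_h] = ∫₀¹ s² · Du₂(scaleH s x)[x_h] ds`. [folklore] -/
theorem fderiv_axialRayMean_horiz (hu : ContDiff ℝ 1 u) (x : EuclideanSpace ℝ (Fin 3)) :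
    fderiv ℝ (fun x => ∫ s in (0 : ℝ)..1, s * u (scaleH s x) 2) x (((x 0) • EuclideanSpace.single (0 : Fin 3) (1 : ℝ) + (x 1) • EuclideanSpace.single (1 : Fin 3) (1 : ℝ))) =
      ∫ s in (0 : ℝ)..1, s ^ 2 * fderiv ℝ u (scaleH s x) (((x 0) • EuclideanSpace.single (0 : Fin 3) (1 : ℝ) + (x 1) • EuclideanSpace.single (1 : Fin 3) (1 : ℝ))) 2 := by
  rw [fderiv_axialRayMean_apply hu]
  refine intervalIntegral.integral_congr fun s _ => ?_
  show s * fderiv ℝ u (scaleH s x) (scaleH s (((x 0) • EuclideanSpace.single (0 : Fin 3) (1 : ℝ) + (x 1) • EuclideanSpace.single (1 : Fin 3) (1 : ℝ)))) 2 = s ^ 2 * fderiv ℝ u (scaleH s x) (((x 0) • EuclideanSpace.single (0 : Fin 3) (1 : ℝ) + (x 1) • EuclideanSpace.single (1 : Fin 3) (1 : ℝ))) 2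
  rw [scaleH_horiz, map_smul]
  show s * (s • fderiv ℝ u (scaleH s x) (((x 0) • EuclideanSpace.single (0 : Fin 3) (1 : ℝ) + (x 1) • EuclideanSpace.single (1 : Fin 3) (1 : ℝ)))) 2 = s ^ 2 * fderiv ℝ u (scaleH s x) (((x 0) • EuclideanSpace.single (0 : Fin 3) (1 : ℝ) + (x 1) • EuclideanSpace.single (1 : Fin 3) (1 : ℝ))) 2
  rw [PiLp.smul_apply, smul_eq_mul]
  ring

/-- **(P3) The axial component**: `u₂ = 2α + x_h · ∇α` (fundamental theorem of calculus along
`s ↦ s² u₂(scaleH s x)`). [folklore] -/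
theorem apply_two_eq (hu : ContDiff ℝ 1 u) (x : EuclideanSpace ℝ (Fin 3)) :
    u x 2 = 2 * (∫ s in (0 : ℝ)..1, s * u (scaleH s x) 2) + fderiv ℝ (fun x => ∫ s in (0 : ℝ)..1, s * u (scaleH s x) 2) x (((x 0) • EuclideanSpace.single (0 : Fin 3) (1 : ℝ) + (x 1) • EuclideanSpace.single (1 : Fin 3) (1 : ℝ))) := by
  have hg : ∀ s, HasDerivAt (fun s : ℝ => s ^ 2 * u (scaleH s x) 2)
      (2 * s * u (scaleH s x) 2 + s ^ 2 * fderiv ℝ u (scaleH s x) (((x 0) • EuclideanSpace.single (0 : Fin 3) (1 : ℝ) + (x 1) • EuclideanSpace.single (1 : Fin 3) (1 : ℝ))) 2) s := fun s => by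
    have h1 : HasDerivAt (fun s : ℝ => s ^ 2) (2 * s) s := by simpa using hasDerivAt_pow 2 s
    have h2 := hasDerivAt_apply_comp_scaleH hu x 2 s
    exact h1.mul h2
  have hc1 : Continuous fun s : ℝ => 2 * s * u (scaleH s x) 2 :=
    (continuous_const.mul continuous_id).mul (continuous_apply_comp_scaleH hu.continuous x 2)
  have hc2 : Continuous fun s : ℝ => s ^ 2 * fderiv ℝ u (scaleH s x) (((x 0) • EuclideanSpace.single (0 : Fin 3) (1 : ℝ) + (x 1) • EuclideanSpace.single (1 : Fin 3) (1 : ℝ))) 2 :=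
    (continuous_pow 2).mul (continuous_fderiv_scaleH_apply hu x _ 2)
  have hftc := intervalIntegral.integral_eq_sub_of_hasDerivAt (fun s _ => hg s)
    ((hc1.add hc2).intervalIntegrable 0 1)
  simp only [scaleH_one, one_pow, one_mul, ne_eq, OfNat.ofNat_ne_zero, not_false_eq_true,
    zero_pow, zero_mul, sub_zero] at hftc
  rw [← hftc, intervalIntegral.integral_add (hc1.intervalIntegrable 0 1) (hc2.intervalIntegrable 0 1),
    fderiv_axialRayMean_horiz hu, ← intervalIntegral.integral_const_mul]
  congr 1
  refine intervalIntegral.integral_congr fun s _ => ?_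
  simp only
  ring

/-- Derivatives of the swirl `Γ = x₀u₁ − x₁u₀ ≡ 0` of a swirl-free field: along `e₁`,
`x₀ ∂₁u₁ − x₁ ∂₁u₀ = u₀`; along `e₀`, `x₁ ∂₀u₀ − x₀ ∂₀u₁ = u₁`. [folklore] -/
theorem noSwirl_fderiv (hu : ContDiff ℝ 1 u) (hns : HasNoSwirl u) (y : EuclideanSpace ℝ (Fin 3)) :
    y 0 * fderiv ℝ u y (EuclideanSpace.single (1 : Fin 3) (1 : ℝ)) 1 -
        y 1 * fderiv ℝ u y (EuclideanSpace.single (1 : Fin 3) (1 : ℝ)) 0 = u y 0 ∧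
      y 1 * fderiv ℝ u y (EuclideanSpace.single (0 : Fin 3) (1 : ℝ)) 0 -
        y 0 * fderiv ℝ u y (EuclideanSpace.single (0 : Fin 3) (1 : ℝ)) 1 = u y 1 := by
  have hd : ∀ i : Fin 3, HasFDerivAt (fun y => u y i)
      ((EuclideanSpace.proj (𝕜 := ℝ) i).comp (fderiv ℝ u y)) y := fun i =>
    (EuclideanSpace.proj (𝕜 := ℝ) i).hasFDerivAt.comp _ ((hu.differentiable one_ne_zero) _).hasFDerivAt
  have hp : ∀ i : Fin 3, HasFDerivAt (fun y : EuclideanSpace ℝ (Fin 3) => y i)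
      (EuclideanSpace.proj (𝕜 := ℝ) i) y := fun i => (EuclideanSpace.proj (𝕜 := ℝ) i).hasFDerivAt
  have hS : HasFDerivAt (swirl u)
      (y 0 • (EuclideanSpace.proj (𝕜 := ℝ) (1 : Fin 3)).comp (fderiv ℝ u y) +
          u y 1 • EuclideanSpace.proj (𝕜 := ℝ) (0 : Fin 3) -
        (y 1 • (EuclideanSpace.proj (𝕜 := ℝ) (0 : Fin 3)).comp (fderiv ℝ u y) +
          u y 0 • EuclideanSpace.proj (𝕜 := ℝ) (1 : Fin 3))) y :=
    ((hp 0).mul (hd 1)).sub ((hp 1).mul (hd 0))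
  have hzero : swirl u = fun _ => 0 := funext hns
  have hf : fderiv ℝ (swirl u) y = 0 := by rw [hzero]; exact fderiv_const_apply 0
  have key := hS.fderiv
  rw [hf] at key
  have k1 := congrArg (fun L : EuclideanSpace ℝ (Fin 3) →L[ℝ] ℝ => L (EuclideanSpace.single (1 : Fin 3) (1 : ℝ))) key
  have k0 := congrArg (fun L : EuclideanSpace ℝ (Fin 3) →L[ℝ] ℝ => L (EuclideanSpace.single (0 : Fin 3) (1 : ℝ))) key
  simp only [zero_apply, sub_apply, add_apply, smul_apply, ContinuousLinearMap.comp_apply,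
    smul_eq_mul] at k1 k0
  have e1 : (EuclideanSpace.proj (𝕜 := ℝ) (0 : Fin 3)) (EuclideanSpace.single (1 : Fin 3) (1 : ℝ)) = 0 := by
    simp
  have e2 : (EuclideanSpace.proj (𝕜 := ℝ) (1 : Fin 3)) (EuclideanSpace.single (1 : Fin 3) (1 : ℝ)) = 1 := by
    simp
  have e3 : (EuclideanSpace.proj (𝕜 := ℝ) (0 : Fin 3)) (EuclideanSpace.single (0 : Fin 3) (1 : ℝ)) = 1 := by
    simp
  have e4 : (EuclideanSpace.proj (𝕜 := ℝ) (1 : Fin 3)) (EuclideanSpace.single (0 : Fin 3) (1 : ℝ)) = 0 := by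
    simp
  rw [e1, e2] at k1
  rw [e3, e4] at k0
  have p1 : ∀ v, (EuclideanSpace.proj (𝕜 := ℝ) (1 : Fin 3)) (fderiv ℝ u y v) = fderiv ℝ u y v 1 :=
    fun v => rfl
  have p0 : ∀ v, (EuclideanSpace.proj (𝕜 := ℝ) (0 : Fin 3)) (fderiv ℝ u y v) = fderiv ℝ u y v 0 :=
    fun v => rfl
  simp only [p1, p0] at k1 k0
  constructor <;> linarith

/-- **(Q) The radial components through the horizontal divergence** (swirl-free fields):
`y_i (∂₀u₀ + ∂₁u₁) = u_i + Du(y)[y_h]_i` for `i = 0, 1`. [folklore] -/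
theorem apply_mul_hdiv_eq (hu : ContDiff ℝ 1 u) (hns : HasNoSwirl u) (y : EuclideanSpace ℝ (Fin 3)) :
    (y 0 * (fderiv ℝ u y (EuclideanSpace.single (0 : Fin 3) (1 : ℝ)) 0 +
        fderiv ℝ u y (EuclideanSpace.single (1 : Fin 3) (1 : ℝ)) 1) = u y 0 + fderiv ℝ u y (((y 0) • EuclideanSpace.single (0 : Fin 3) (1 : ℝ) + (y 1) • EuclideanSpace.single (1 : Fin 3) (1 : ℝ))) 0) ∧
      (y 1 * (fderiv ℝ u y (EuclideanSpace.single (0 : Fin 3) (1 : ℝ)) 0 +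
        fderiv ℝ u y (EuclideanSpace.single (1 : Fin 3) (1 : ℝ)) 1) = u y 1 + fderiv ℝ u y (((y 0) • EuclideanSpace.single (0 : Fin 3) (1 : ℝ) + (y 1) • EuclideanSpace.single (1 : Fin 3) (1 : ℝ))) 1) := by
  obtain ⟨h1, h0⟩ := noSwirl_fderiv hu hns y
  simp only [map_add, map_smul, PiLp.add_apply, PiLp.smul_apply, smul_eq_mul]
  constructor <;> linarith

/-- **(Ph) The radial components**: for a swirl-free divergence-free `u ∈ C¹`,
`u_i = −x_i ∂₂α` (`i = 0, 1`), i.e. `u_r = −∂_zψ/r`. [folklore] -/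
theorem apply_horiz_eq (hu : ContDiff ℝ 1 u) (hdiv : VectorCalculus.IsDivFree u) (hns : HasNoSwirl u)
    (x : EuclideanSpace ℝ (Fin 3)) :
    u x 0 = -(x 0) * fderiv ℝ (fun x => ∫ s in (0 : ℝ)..1, s * u (scaleH s x) 2) x (EuclideanSpace.single (2 : Fin 3) (1 : ℝ)) ∧
      u x 1 = -(x 1) * fderiv ℝ (fun x => ∫ s in (0 : ℝ)..1, s * u (scaleH s x) 2) x (EuclideanSpace.single (2 : Fin 3) (1 : ℝ)) := by
  rw [fderiv_axialRayMean_single_two hu, ← intervalIntegral.integral_const_mul,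
    ← intervalIntegral.integral_const_mul]
  -- the integrands are the derivatives of `s ↦ s · u_i(scaleH s x)`
  have hder : ∀ i : Fin 3, ∀ s, HasDerivAt (fun s : ℝ => s * u (scaleH s x) i)
      (u (scaleH s x) i + s * fderiv ℝ u (scaleH s x) (((x 0) • EuclideanSpace.single (0 : Fin 3) (1 : ℝ) + (x 1) • EuclideanSpace.single (1 : Fin 3) (1 : ℝ))) i) s := fun i s => by
    have h := (hasDerivAt_id' s).mul (hasDerivAt_apply_comp_scaleH hu x i s)
    simp only [one_mul] at h
    exact h
  have hint : ∀ i : Fin 3, ∫ s in (0 : ℝ)..1, (u (scaleH s x) i + s * fderiv ℝ u (scaleH s x) (((x 0) • EuclideanSpace.single (0 : Fin 3) (1 : ℝ) + (x 1) • EuclideanSpace.single (1 : Fin 3) (1 : ℝ))) i)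
      = u x i := fun i => by
    have hc : Continuous fun s : ℝ => u (scaleH s x) i + s * fderiv ℝ u (scaleH s x) (((x 0) • EuclideanSpace.single (0 : Fin 3) (1 : ℝ) + (x 1) • EuclideanSpace.single (1 : Fin 3) (1 : ℝ))) i :=
      (continuous_apply_comp_scaleH hu.continuous x i).add
        (continuous_id.mul (continuous_fderiv_scaleH_apply hu x _ i))
    have h := intervalIntegral.integral_eq_sub_of_hasDerivAt (fun s _ => hder i s) (hc.intervalIntegrable 0 1)
    simpa using h
  -- pointwise identity of integrands via div-free at `scaleH s x` and (Q)
  have hpt : ∀ s : ℝ,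
      (-(x 0) * (s * fderiv ℝ u (scaleH s x) (EuclideanSpace.single (2 : Fin 3) (1 : ℝ)) 2) =
          u (scaleH s x) 0 + s * fderiv ℝ u (scaleH s x) (((x 0) • EuclideanSpace.single (0 : Fin 3) (1 : ℝ) + (x 1) • EuclideanSpace.single (1 : Fin 3) (1 : ℝ))) 0) ∧
        (-(x 1) * (s * fderiv ℝ u (scaleH s x) (EuclideanSpace.single (2 : Fin 3) (1 : ℝ)) 2) =
          u (scaleH s x) 1 + s * fderiv ℝ u (scaleH s x) (((x 0) • EuclideanSpace.single (0 : Fin 3) (1 : ℝ) + (x 1) • EuclideanSpace.single (1 : Fin 3) (1 : ℝ))) 1) := fun s => by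
    have hd := hdiv (scaleH s x)
    rw [divergence_eq_sum_three] at hd
    obtain ⟨q0, q1⟩ := apply_mul_hdiv_eq hu hns (scaleH s x)
    rw [horiz_scaleH, map_smul] at q0 q1
    simp only [scaleH_apply_zero, scaleH_apply_one, PiLp.smul_apply, smul_eq_mul] at q0 q1
    constructor
    · have : fderiv ℝ u (scaleH s x) (EuclideanSpace.single (2 : Fin 3) (1 : ℝ)) 2 =
          -(fderiv ℝ u (scaleH s x) (EuclideanSpace.single (0 : Fin 3) (1 : ℝ)) 0 +
            fderiv ℝ u (scaleH s x) (EuclideanSpace.single (1 : Fin 3) (1 : ℝ)) 1) := by linarith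
      rw [this]; linarith
    · have : fderiv ℝ u (scaleH s x) (EuclideanSpace.single (2 : Fin 3) (1 : ℝ)) 2 =
          -(fderiv ℝ u (scaleH s x) (EuclideanSpace.single (0 : Fin 3) (1 : ℝ)) 0 +
            fderiv ℝ u (scaleH s x) (EuclideanSpace.single (1 : Fin 3) (1 : ℝ)) 1) := by linarith
      rw [this]; linarith
  constructor
  · rw [← hint 0]
    exact (intervalIntegral.integral_congr fun s _ => (hpt s).1).symm
  · rw [← hint 1]
    exact (intervalIntegral.integral_congr fun s _ => (hpt s).2).symm

end Summit.NavierStokesRegularity.HeredityAtOneEnergyBound
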